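import Summits.Ventures.PercRepro.S1FiveCircuitChain

/-!
# PercRepro — THE BASE OF THE `s₅` CHAIN: `s₅ ≤ 52` ON EVERY `e`-FREE CORE OF NULLITY `4` (p2, gen 20; SUBCLAIM-S1 §6.4)

The crude count `s₅ ≤ C(8, 5) = 56` at nullity `4` is attained only by `U(4, 8)`, which is not `e`-free. On a core:
let `K` be the coloops and `E' = E ∖ K`, `|E'| = r(E') + 4` with `r(E') ≥ 4`, so `|E'| ≥ 8` (`nonColoops_nullity_four`).

* If `|E'| ≥ 9`, the averaging recursion (S1FiveCircuitChain) with `m = 9` on the crude `s₅ ≤ 21` at nullity `3`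
  gives `s₅ − ⌊5·s₅/9⌋ ≤ 21`, i.e. `s₅ ≤ 47` (`ncard_fiveCircuits_le_forty_seven_of_nine`).
* If `|E'| = 8`, then `r(E') = 4` and every five-circuit is one of the `56` five-subsets of `E'`. Take any `e ∈ E'`
  and its `e`-free partition `A ⊔ A'` of `E ∖ {e}`: the halves `A ∩ E'` and `A' ∩ E'` cover `E' ∖ {e}` (seven
  points) and each has rank `≤ 3` (rank `4` would make its closure `cl E' ∋ e`), so one of them has `≥ 4` points of
  rank `≤ 3`, hence contains a circuit `D` with `≤ 4` elements. No five-circuit contains `D` (a circuit contains no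
  other circuit), and at least `C(8 − |D|, 5 − |D|) ≥ 4` five-subsets of `E'` do: `s₅ ≤ 56 − 4 = 52`
  (`ncard_fiveCircuits_le_fifty_two_of_eight`).

So `s₅ ≤ 52` at nullity `4` (`ncard_fiveCircuits_le_fifty_two`), and the chain restarted from `52`
(`avgChain5b`: `117, 234, 401, 651, 1012, 1518, …` at `ν = 5 …` against `126, 252, 432, 702, 1092, 1638`) closes
THE CELL `(10, 10)` (`cellOK14 10 10 20 216 1518`; the cell needs `s₅ ≤ 1544`; twin `0.9968`): an `e`-free core of
rank `10` with `20` points satisfies `RLS` at level `4` (`c025_core_ten_ten`). The engine's complete catalogue of the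
matroids on `≤ 9` points gives the `e`-free maximum `s₅ = 44` at nullity `4` (`n = 8`, rank `4`).
Axioms: standard.
-/

open scoped Matroid

namespace PercRepro

namespace S1

open Set

open FourCap

variable {α : Type}

/-- **The non-coloop part of a core of nullity `4`**: `|E'| = r(E') + 4` with `r(E') ≥ 4` (rank `≤ 3` gives `≤ 6`
points, hence rank `≤ 2` and `≤ 3` points — against `≥ 4`). -/
theorem nonColoops_nullity_four (M : Matroid α) [M.Finite]
    (hfree : ∀ e ∈ M.E, ∃ A ⊆ M.E \ {e}, e ∉ M.closure A ∧ e ∉ M.closure ((M.E \ {e}) \ A))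
    (hd : M.E.encard = M.eRank + 4) :
    ∃ r' : ℕ, M.eRk (M.E \ M.coloops) = r' ∧ (M.E \ M.coloops).ncard = r' + 4 ∧ 4 ≤ r' := by
  have hK : M.coloops ⊆ M.E := M.coloops_subset_ground
  have hE' : M.E \ M.coloops ⊆ M.E := sdiff_subset
  have hunion : (M.E \ M.coloops) ∪ M.coloops = M.E := sdiff_union_of_subset hK
  have hr := PercRepro.eRk_union_subset_coloops (M := M) hE' subset_rfl disjoint_sdiff_left
  rw [hunion, ← _root_.Matroid.eRank_def] at hr
  have hcard := ncard_sdiff_add_ncard_of_subset hK M.ground_finite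
  have hKfin : M.coloops.Finite := M.ground_finite.subset hK
  have hrE' : M.eRk (M.E \ M.coloops) ≠ ⊤ :=
    ne_top_of_le_ne_top (M.ground_finite.subset hE').encard_lt_top.ne (M.eRk_le_encard _)
  obtain ⟨r', hr'⟩ := ENat.ne_top_iff_exists.1 hrE'
  obtain ⟨R, hR⟩ := ENat.ne_top_iff_exists.1 (PercRepro.Matroid.eRank_ne_top_of_finite M)
  have hRk : R = r' + M.coloops.ncard := by
    have := hr
    rw [← hR, ← hr', ← Set.Finite.cast_ncard_eq hKfin] at this
    exact_mod_cast this
  have hEn : M.E.ncard = R + 4 := by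
    have := hd
    rw [← hR, ← Set.Finite.cast_ncard_eq M.ground_finite] at this
    exact_mod_cast this
  have hE'n : (M.E \ M.coloops).ncard = r' + 4 := by omega
  refine ⟨r', hr'.symm, hE'n, ?_⟩
  by_contra hlt
  push Not at hlt
  have hr'3 : r' ≤ 3 := by omega
  have h6 := ThmN.ncard_le_six_of_eRk_le_three_of_free M hfree hE' (by rw [← hr']; exact_mod_cast hr'3)
  have hr'2 : r' ≤ 2 := by omega
  have h3 := ThmN.ncard_add_one_le_two_pow_of_eRk_le M (ThmN.not_isLoop_of_free M hfree) hfree 2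
    (M.E \ M.coloops) hE' (by rw [← hr']; exact_mod_cast hr'2)
  norm_num at h3
  omega

/-- **`s₅ ≤ 47` on a core of nullity `4` with at least `9` non-coloops**: the averaging recursion with `m = 9` on
the crude `s₅ ≤ C(7, 5) = 21` at nullity `3`. -/
theorem ncard_fiveCircuits_le_forty_seven_of_nine (M : Matroid α) [M.Finite]
    (hfree : ∀ e ∈ M.E, ∃ A ⊆ M.E \ {e}, e ∉ M.closure A ∧ e ∉ M.closure ((M.E \ {e}) \ A))
    (hd : M.E.encard = M.eRank + 4) (h9 : 9 ≤ (M.E \ M.coloops).ncard) :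
    {C : Set α | M.IsCircuit C ∧ C.ncard = 5}.ncard ≤ 47 := by
  have hd' : M.E.encard = M.eRank + ((3 : ℕ) + 1) := by rw [hd]; norm_num
  have h := ncard_fiveCircuits_sub_div_le_of_nonColoops M hfree hd' (by norm_num) h9 (B := 21)
    (fun M' _ _ hd3 => (ncard_circuits_five_le M' hd3).trans (by decide))
  omega

/-- **The kill count**: in an `8`-element finset `Ef`, at least `4` of the `5`-subsets contain a given subset `Df`
with `≤ 4` elements (`C(8 − |Df|, 5 − |Df|) ≥ 4`). -/
theorem four_le_card_filter_subset (Ef Df : Finset α) [DecidableEq α] (hE : Ef.card = 8) (hDE : Df ⊆ Ef)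
    (hD : Df.card ≤ 4) :
    4 ≤ ((Ef.powersetCard 5).filter (fun S => Df ⊆ S)).card := by
  have hmaps : Set.MapsTo (fun T => Df ∪ T) ((Ef \ Df).powersetCard (5 - Df.card))
      ((Ef.powersetCard 5).filter (fun S => Df ⊆ S)) := by
    intro T hT
    rw [Finset.mem_coe, Finset.mem_powersetCard] at hT
    rw [Finset.mem_coe, Finset.mem_filter, Finset.mem_powersetCard]
    refine ⟨⟨Finset.union_subset hDE (hT.1.trans Finset.sdiff_subset), ?_⟩, Finset.subset_union_left⟩
    rw [Finset.card_union_of_disjoint (Finset.disjoint_of_subset_right hT.1 Finset.disjoint_sdiff), hT.2]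
    omega
  have hinj : Set.InjOn (fun T => Df ∪ T) ((Ef \ Df).powersetCard (5 - Df.card)) := by
    intro T₁ hT₁ T₂ hT₂ h
    rw [Finset.mem_coe, Finset.mem_powersetCard] at hT₁ hT₂
    have e₁ : (Df ∪ T₁) \ Df = T₁ := Finset.union_sdiff_cancel_left (Finset.disjoint_of_subset_right hT₁.1 Finset.disjoint_sdiff)
    have e₂ : (Df ∪ T₂) \ Df = T₂ := Finset.union_sdiff_cancel_left (Finset.disjoint_of_subset_right hT₂.1 Finset.disjoint_sdiff)
    simp only at h
    rw [← e₁, ← e₂, h]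
  have hle := Finset.card_le_card_of_injOn _ hmaps hinj
  rw [Finset.card_powersetCard, Finset.card_sdiff_of_subset hDE, hE] at hle
  have hchoose : 4 ≤ (8 - Df.card).choose (5 - Df.card) := by
    have : Df.card ≤ 4 := hD
    interval_cases Df.card <;> decide
  omega

/-- **`s₅ ≤ 52` on a core of nullity `4` with exactly `8` non-coloops** (the `8`-point rank-`4` case: one small
circuit inside `E'` kills `≥ 4` of the `56` five-subsets). -/
theorem ncard_fiveCircuits_le_fifty_two_of_eight (M : Matroid α) [M.Finite]
    (hfree : ∀ e ∈ M.E, ∃ A ⊆ M.E \ {e}, e ∉ M.closure A ∧ e ∉ M.closure ((M.E \ {e}) \ A))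
    (hd : M.E.encard = M.eRank + 4) (h8 : (M.E \ M.coloops).ncard = 8) :
    {C : Set α | M.IsCircuit C ∧ C.ncard = 5}.ncard ≤ 52 := by
  classical
  obtain ⟨r', hr', hE'n, hr4⟩ := nonColoops_nullity_four M hfree hd
  have hr'4 : r' = 4 := by omega
  set E' := M.E \ M.coloops with hE'def
  have hE'sub : E' ⊆ M.E := sdiff_subset
  have hE'fin : E'.Finite := M.ground_finite.subset hE'sub
  have hrkE' : M.eRk E' = 4 := by rw [hr', hr'4]; rfl
  -- a point `e` of `E'` and its `e`-free partition
  have hne : E'.Nonempty := by rw [← ncard_pos hE'fin]; omega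
  obtain ⟨e, he⟩ := hne
  obtain ⟨A, hA, heA, heA'⟩ := hfree e (hE'sub he)
  -- the halves inside `E'` cover `E' ∖ {e}` and have rank `≤ 3`
  have hrank : ∀ X ⊆ E', e ∉ M.closure X → M.eRk X ≤ 3 := by
    intro X hXE' heX
    by_contra hlt
    push Not at hlt
    have h4 : (4 : ℕ∞) ≤ M.eRk X := by
      have := Order.add_one_le_of_lt hlt
      exact le_trans (by norm_num) this
    have hcl : M.closure X = M.closure E' :=
      (M.isRkFinite_of_finite (hE'fin.subset hXE')).closure_eq_closure_of_subset_of_eRk_ge_eRk hXE'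
        (by rw [hrkE']; exact h4)
    exact heX (hcl ▸ M.subset_closure E' hE'sub he)
  have hA1 : M.eRk (A ∩ E') ≤ 3 :=
    hrank _ inter_subset_right (fun h => heA (M.closure_subset_closure inter_subset_left h))
  have hB1 : M.eRk (((M.E \ {e}) \ A) ∩ E') ≤ 3 :=
    hrank _ inter_subset_right (fun h => heA' (M.closure_subset_closure inter_subset_left h))
  have hcover : E' \ {e} ⊆ (A ∩ E') ∪ (((M.E \ {e}) \ A) ∩ E') := by
    intro x hx
    by_cases hxA : x ∈ A
    · exact Or.inl ⟨hxA, hx.1⟩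
    · exact Or.inr ⟨⟨⟨hE'sub hx.1, hx.2⟩, hxA⟩, hx.1⟩
  have hcard : 4 ≤ (A ∩ E').ncard ∨ 4 ≤ (((M.E \ {e}) \ A) ∩ E').ncard := by
    by_contra hno
    push Not at hno
    have h1 := ncard_le_ncard hcover
      ((hE'fin.subset inter_subset_right).union (hE'fin.subset inter_subset_right))
    have h2 := ncard_union_le (A ∩ E') (((M.E \ {e}) \ A) ∩ E')
    have h3 := ncard_sdiff_singleton_add_one he hE'fin
    omega
  -- a `4`-point subset of rank `≤ 3`, a circuit `D` inside it
  obtain ⟨X, hXE', hX4, hXr⟩ : ∃ X ⊆ E', 4 ≤ X.ncard ∧ M.eRk X ≤ 3 := by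
    rcases hcard with h | h
    · exact ⟨A ∩ E', inter_subset_right, h, hA1⟩
    · exact ⟨((M.E \ {e}) \ A) ∩ E', inter_subset_right, h, hB1⟩
  obtain ⟨Y, hYX, hY4⟩ := Set.exists_subset_card_eq hX4
  have hYE' : Y ⊆ E' := hYX.trans hXE'
  have hYfin : Y.Finite := hE'fin.subset hYE'
  have hYdep : M.Dep Y := by
    rw [← Matroid.eRk_lt_encard_iff_dep_of_finite hYfin (hYE'.trans hE'sub)]
    have hYenc : Y.encard = 4 := by rw [← hYfin.cast_ncard_eq, hY4]; rfl
    rw [hYenc]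
    exact lt_of_le_of_lt ((M.eRk_mono hYX).trans hXr) (by norm_num)
  obtain ⟨D, hDY, hD⟩ := hYdep.exists_isCircuit_subset
  have hDE' : D ⊆ E' := hDY.trans hYE'
  have hDfin : D.Finite := hE'fin.subset hDE'
  have hD4 : D.ncard ≤ 4 := by rw [← hY4]; exact ncard_le_ncard hDY hYfin
  -- THE COUNT in finsets
  set Ef := hE'fin.toFinset with hEf
  set Df := hDfin.toFinset with hDf
  have hEfcard : Ef.card = 8 := by rw [hEf, ← ncard_eq_toFinset_card _ hE'fin]; exact h8
  have hDfE : Df ⊆ Ef := by rw [hDf, hEf, Set.Finite.toFinset_subset_toFinset]; exact hDE'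
  have hDfcard : Df.card ≤ 4 := by rw [hDf, ← ncard_eq_toFinset_card _ hDfin]; exact hD4
  set P := Ef.powersetCard 5 with hP
  set Q := P.filter (fun S => Df ⊆ S) with hQ
  have hQP : Q ⊆ P := Finset.filter_subset _ _
  have hQ4 : 4 ≤ Q.card := four_le_card_filter_subset Ef Df hEfcard hDfE hDfcard
  have hPcard : P.card = 56 := by rw [hP, Finset.card_powersetCard, hEfcard]; rfl
  -- every five-circuit is the coercion of a member of `P \ Q`
  have hsub : {C : Set α | M.IsCircuit C ∧ C.ncard = 5} ⊆ (fun S : Finset α => (S : Set α)) '' ((P \ Q : Finset (Finset α)) : Set (Finset α)) := by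
    rintro C ⟨hC, hC5⟩
    have hCE' : C ⊆ E' := fun x hx => ⟨hC.subset_ground hx, hC.not_isColoop_of_mem hx⟩
    have hCfin : C.Finite := hE'fin.subset hCE'
    refine ⟨hCfin.toFinset, ?_, by simp⟩
    rw [Finset.mem_coe, Finset.mem_sdiff, hP, Finset.mem_powersetCard, hQ, Finset.mem_filter]
    refine ⟨⟨?_, ?_⟩, ?_⟩
    · rw [hEf, Set.Finite.toFinset_subset_toFinset]; exact hCE'
    · rw [← ncard_eq_toFinset_card _ hCfin]; exact hC5
    · rintro ⟨_, hDC⟩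
      rw [hDf, Set.Finite.toFinset_subset_toFinset] at hDC
      have := hD.eq_of_subset_isCircuit hC hDC
      rw [this] at hD4
      omega
  calc {C : Set α | M.IsCircuit C ∧ C.ncard = 5}.ncard
      ≤ ((fun S : Finset α => (S : Set α)) '' ((P \ Q : Finset (Finset α)) : Set (Finset α))).ncard :=
        ncard_le_ncard hsub ((P \ Q).finite_toSet.image _)
    _ ≤ ((P \ Q : Finset (Finset α)) : Set (Finset α)).ncard := ncard_image_le (P \ Q).finite_toSet
    _ = (P \ Q).card := ncard_coe_finset _
    _ = P.card - Q.card := Finset.card_sdiff_of_subset hQP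
    _ ≤ 52 := by omega

/-- **`s₅ ≤ 52` on every core of nullity `4`**, unconditionally (`≥ 9` non-coloops: `47`; exactly `8`: `52`). -/
theorem ncard_fiveCircuits_le_fifty_two (M : Matroid α) [M.Finite]
    (hfree : ∀ e ∈ M.E, ∃ A ⊆ M.E \ {e}, e ∉ M.closure A ∧ e ∉ M.closure ((M.E \ {e}) \ A))
    (hd : M.E.encard = M.eRank + 4) : {C : Set α | M.IsCircuit C ∧ C.ncard = 5}.ncard ≤ 52 := by
  obtain ⟨r', _, hE'n, hr4⟩ := nonColoops_nullity_four M hfree hd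
  rcases Nat.lt_or_ge (M.E \ M.coloops).ncard 9 with h | h
  · exact ncard_fiveCircuits_le_fifty_two_of_eight M hfree hd (by omega)
  · exact (ncard_fiveCircuits_le_forty_seven_of_nine M hfree hd h).trans (by norm_num)

/-- The `s₅` chain restarted from `52` at nullity `4`: `117, 234` at `ν = 5, 6` (`m = 9, 10`), then
`avgChain5b (n + 7) = ⌊(n + 12)·avgChain5b (n + 6)/(n + 7)⌋`: `401, 651, 1012, 1518, 2258, 3199, 4427, …`. -/
def avgChain5b : ℕ → ℕ
  | 0 => 0
  | 1 => 1
  | 2 => 6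
  | 3 => 21
  | 4 => 52
  | 5 => 117
  | 6 => 234
  | n + 7 => (n + 12) * avgChain5b (n + 6) / (n + 12 - 5)

/-- The values `avgChain5b 7 = 401`, `8 ↦ 651`, `9 ↦ 1012`, `10 ↦ 1518`. -/
theorem avgChain5b_values : avgChain5b 7 = 401 ∧ avgChain5b 8 = 651 ∧ avgChain5b 9 = 1012 ∧
    avgChain5b 10 = 1518 := by decide

/-- **`s₅ ≤ 117` on every core of nullity `5`** (the recursion with `m = 9` on `52`). -/
theorem ncard_fiveCircuits_le_one_seventeen (M : Matroid α) [M.Finite]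
    (hfree : ∀ e ∈ M.E, ∃ A ⊆ M.E \ {e}, e ∉ M.closure A ∧ e ∉ M.closure ((M.E \ {e}) \ A))
    (hd : M.E.encard = M.eRank + 5) : {C : Set α | M.IsCircuit C ∧ C.ncard = 5}.ncard ≤ 117 := by
  have hd' : M.E.encard = M.eRank + ((4 : ℕ) + 1) := by rw [hd]; norm_num
  have h := ncard_fiveCircuits_sub_div_le_of_nonColoops M hfree hd' (by norm_num)
    (card_nonColoops_ge_nine M hfree hd) (B := 52)
    (fun M' _ hfree' hd4 => ncard_fiveCircuits_le_fifty_two M' hfree' (by exact_mod_cast hd4))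
  omega

/-- **`s₅ ≤ 234` on every core of nullity `6`** (the recursion with `m = 10` on `117`). -/
theorem ncard_fiveCircuits_le_two_thirty_four (M : Matroid α) [M.Finite]
    (hfree : ∀ e ∈ M.E, ∃ A ⊆ M.E \ {e}, e ∉ M.closure A ∧ e ∉ M.closure ((M.E \ {e}) \ A))
    (hd : M.E.encard = M.eRank + 6) : {C : Set α | M.IsCircuit C ∧ C.ncard = 5}.ncard ≤ 234 := by
  have hd' : M.E.encard = M.eRank + ((5 : ℕ) + 1) := by rw [hd]; norm_num
  have h := ncard_fiveCircuits_sub_div_le_of_nonColoops M hfree hd' (by norm_num)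
    (card_nonColoops_ge_ten M hfree hd) (B := 117)
    (fun M' _ hfree' hd5 => ncard_fiveCircuits_le_one_seventeen M' hfree' (by exact_mod_cast hd5))
  omega

/-- **`s₅ ≤ avgChain5b ν` on every core of nullity `ν`**, unconditionally. -/
theorem ncard_fiveCircuits_le_avgChain5b : ∀ (j : ℕ) (M : Matroid α) [M.Finite],
    (∀ e ∈ M.E, ∃ A ⊆ M.E \ {e}, e ∉ M.closure A ∧ e ∉ M.closure ((M.E \ {e}) \ A)) →
    M.E.encard = M.eRank + j → {C : Set α | M.IsCircuit C ∧ C.ncard = 5}.ncard ≤ avgChain5b j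
  | 0, M, _, _, hd => (ncard_circuits_five_le M hd).trans (by decide)
  | 1, M, _, _, hd => (ncard_circuits_five_le M hd).trans (by decide)
  | 2, M, _, _, hd => (ncard_circuits_five_le M hd).trans (by decide)
  | 3, M, _, _, hd => (ncard_circuits_five_le M hd).trans (by decide)
  | 4, M, _, hfree, hd => ncard_fiveCircuits_le_fifty_two M hfree (by exact_mod_cast hd)
  | 5, M, _, hfree, hd => ncard_fiveCircuits_le_one_seventeen M hfree (by exact_mod_cast hd)
  | 6, M, _, hfree, hd => ncard_fiveCircuits_le_two_thirty_four M hfree (by exact_mod_cast hd)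
  | n + 7, M, _, hfree, hd => by
    have hd' : M.E.encard = M.eRank + ((n + 6 : ℕ) + 1) := by rw [hd]; push_cast; ring
    have hm : n + 12 ≤ (M.E \ M.coloops).ncard := card_nonColoops_ge M hfree hd' (by omega)
    have h := ncard_fiveCircuits_sub_div_le_of_nonColoops M hfree hd' (by omega) hm
      (fun M' _ hfree' hd6 => ncard_fiveCircuits_le_avgChain5b (n + 6) M' hfree' hd6)
    have h2 := le_mul_div_of_sub_div_le_five (m := n + 12) (by omega) h
    show _ ≤ (n + 12) * avgChain5b (n + 6) / (n + 12 - 5)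
    exact h2

/-- **`s₅ ≤ 1518` on every core of nullity `10`**, unconditionally (the crude count is `2002`; the cell `(10, 10)`
needs `≤ 1544`). -/
theorem ncard_fiveCircuits_le_avgChain5b_ten (M : Matroid α) [M.Finite]
    (hfree : ∀ e ∈ M.E, ∃ A ⊆ M.E \ {e}, e ∉ M.closure A ∧ e ∉ M.closure ((M.E \ {e}) \ A))
    (hd : M.E.encard = M.eRank + 10) : {C : Set α | M.IsCircuit C ∧ C.ncard = 5}.ncard ≤ 1518 := by
  have h := ncard_fiveCircuits_le_avgChain5b 10 M hfree (by exact_mod_cast hd)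
  rwa [avgChain5b_values.2.2.2] at h

end S1

end PercRepro
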